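import Summits.BirchSwinnertonDyer.BirchSwinnertonDyer.Theorems.ByReductionTypeAtTwoSupersingularFlatLiftAssemblyTop
import Literature.NumberTheory.EllipticCurves.Greenberg1999.MordellWeilRankLayerBoundProofs
import Literature.NumberTheory.EllipticCurves.IwasawaSelmerControlCokerProofs
import Literature.NumberTheory.EllipticCurves.SubgroupSelmerCocycleCriteriaProofs
import Literature.NumberTheory.EllipticCurves.ZpExtensionUnramifiedProofs
import Literature.NumberTheory.GaloisRepresentations.DecompositionGroupOfCompletion
import HarnessLib

/-!
# (b₂)' AS A CORANK AT LEVEL `K`: `rank_{ℤ_p} Y/TY = corank_{ℤ_p} H¹(K_Σ/K_∞, E[p^∞])^Γ = corank_{ℤ_p} H¹(K_Σ/K, E[p^∞])`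
# — Pontryagin duality plus Greenberg's control map «is surjective and has finite kernel» (p. 119), as THEOREMS

Seat `bsd-2adic-ss-1` GEN 12, crux `SupersingularRankZeroAtTwo` (item stmt-BirchSwinnertonDyer-19097, route
`ByReductionTypeAtTwo`, rung K4), line `flat_uniform_two` v1, stub (2) `stub_allFlatData`, conjunct COUNT♭@2 —
part 11. The door `flatCountTwo_of_print_of_coinvariantsRank` (part 9) displays (b₂)' «`coinvariantsRank 2 Y ≤ 1`»
for a finitely generated Pontryagin-dual datum `Y` of `H = H¹(ℚ_Σ/ℚ_∞, E[2^∞]) = unramifiedOutside (ker κ) E[2^∞] 2 Σ₀`.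
This file identifies it with the `ℤ_p`-corank of the LEVEL-`K` group `H¹(K_Σ/K, E[p^∞]) = unramifiedOutside ⊤ E[p^∞] p Σ₀`,
the quantity Greenberg counts on pp. 119–120 (cited by name as `Greenberg1999.h1Sigma_zpCorank_le_degree`):
* §1 `coinvariantsRank_eq_zpCorank_endInvariants` — for ANY `IsDualPair (Y, S, ψ)` with `Y` finitely generated
  over `Λ` and `S^ψ[p]` finite, `rank_{ℤ_p} Y/TY = corank_{ℤ_p} S^ψ` (`IsDualPair.exists_coinvariants_addEquiv`,
  `ZpCorank.finrank_eq_zpCorank_of_addEquiv_characterModule`); specialised to a `conj_γ`-stable `H ≤ H¹(K_∞, E[p^∞])`.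
* §2 the control map `res : H¹(K_Σ/K, E[p^∞]) → H¹(K_Σ/K_∞, E[p^∞])^Γ` at level `Γ_K = ⊤` (the currency of parts
  7–9): ONTO (`ZpExtension.mem_range_resOfLe_of_conjH1_eq`, Lemma 3.2, plus «a class whose restriction is
  unramified is unramified» since `I_v ≤ Gal(K̄/K_∞)` for `v ∤ p`), FINITE KERNEL (Lemma 3.1, `finite_ker_layerToInfty`),
  hence `zpCorank (H ⊓ H¹(K_∞)^γ) p = zpCorank H¹(K_Σ/K, E[p^∞]) p` (`zpCorank_eq_of_finite_ker_of_finite_coker`).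
* §3 `coinvariantsRank_eq_zpCorank_unramifiedOutside_top` — the composite, every number field `K`, prime `p`,
  `ℤ_p`-extension `κ`, finite `Σ₀`.
HONEST TAG of COUNT♭@2 after this file: PRINT-by-name {Prop. 4.13 = Cassels, Prop. 4.12, p. 120 corank count}
+ THEOREM + displayed {(b₁) rank 1 [PRINT Kato 12.4], LOC/LOC♭ [kernel-able]}. Nothing about any curve is
asserted; BSD is not proved by any of this.
References: [GreenbergLNM1716] §1 pp. 60, 65, §3 Lemmas 3.1–3.2, §4 pp. 119–120; [Washington1997] Prop. 13.2.
-/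

set_option autoImplicit false
-- the Theorems namespace of this sub repeats the summit name by design (D-0017 nested layout)
set_option linter.dupNamespace false

noncomputable section

open scoped Classical NumberField AddSubgroup

open NumberField IsDedekindDomain

universe u

namespace Summit.BirchSwinnertonDyer.BirchSwinnertonDyer.Theorems.SSFlatEC

open Literature.NumberTheory.EllipticCurves Literature.NumberTheory.GaloisRepresentations
  WeierstrassCurve ZpExtension Literature.NumberTheory.EllipticCurves.IwasawaDual
  Literature.NumberTheory.EllipticCurves.IwasawaAlgebra Literature.NumberTheory.EllipticCurves.GreenbergVatsal2000
  Literature.NumberTheory.EllipticCurves.GreenbergSelmer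

section Pontryagin

variable (p : ℕ) [Fact p.Prime]

/-- **`rank_{ℤ_p} X/TX = corank_{ℤ_p} S^ψ`** for an axiomatic Pontryagin pair `(X, S, ψ)` (`X ≅ Hom(S, ℚ/ℤ)`,
`T ↦ ψ`) with `X` finitely generated over `Λ` and `S^ψ[p]` finite: `X/TX ≅ Hom(S^ψ, ℚ/ℤ)`
(`IsDualPair.exists_coinvariants_addEquiv`) and `rank_{ℤ_p} Hom(S^ψ, ℚ/ℤ) = corank_{ℤ_p} S^ψ`
(`ZpCorank.finrank_eq_zpCorank_of_addEquiv_characterModule`; `coinvariantsRank = finrank_{ℤ_p}`,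
`coinvariantsRank_eq_finrank_int`). Greenberg (1999), §1 pp. 60, 65 («`corank_{ℤ_p}(Sel_E(ℚ)_p)`, which is
equal to `rank_{ℤ_p}(X/TX)`» for `S^Γ`). [cite: GreenbergLNM1716, §1 pp. 60, 65] -/
theorem coinvariantsRank_eq_zpCorank_endInvariants {S : Type*} [AddCommGroup S] (ψ : AddMonoid.End S)
    {X : Type*} [AddCommGroup X] [Module (IwasawaAlgebra p) X] [Module.Finite (IwasawaAlgebra p) X]
    (toDual : X →+ (S →+ AddCircle (1 : ℚ))) (h : IsDualPair p ψ toDual)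
    [Finite (↥(endInvariants ψ))[(p : ℤ)]] :
    coinvariantsRank p X = zpCorank ↥(endInvariants ψ) p := by
  letI : Module ℤ_[p] (coinvariants p X) := Module.compHom _ (algebraMap ℤ_[p] (IwasawaAlgebra p))
  haveI : Module.Finite ℤ_[p] (coinvariants p X) := finite_int_coinvariants p X
  rw [coinvariantsRank_eq_finrank_int]
  obtain ⟨Ψ, -⟩ := h.exists_coinvariants_addEquiv
  have hS : ∀ s : endInvariants ψ, ∃ n : ℕ, p ^ n • s = 0 := fun s ↦ by
    obtain ⟨n, hn⟩ := h.locNil.torsion (s : S)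
    exact ⟨n, Subtype.ext (by rw [AddSubgroupClass.coe_nsmul, hn]; rfl)⟩
  exact ZpCorank.finrank_eq_zpCorank_of_addEquiv_characterModule p hS Ψ

variable {K : Type u} [Field K] [NumberField K] (W : WeierstrassCurve K) {p} (κ : ZpExtension K p)
  {γ : Field.absoluteGaloisGroup K}

/-- **`rank_{ℤ_p} Y/TY = corank_{ℤ_p} H^γ`** for a `conj_γ`-stable subgroup `H ≤ H¹(K_∞, E[p^∞])` (`γ` a
topological generator of the `ℤ_p`-extension `κ`) with a finitely generated Pontryagin-dual datum
`(Y, toDual_Y)` (bijective, `T ↦ conj_γ − 1`, constants through `ℤ_p → ℤ/p^k`) and `H^γ[p]` finite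
(`H^γ = H ⊓ invariantsUnder κ γ`): §1 for `ψ = conj_γ|_H − 1` (local nilpotence: tree
`isLocNil_sub_one_of_coe_eq_conjH1`). Greenberg (1999), §1 p. 65. [cite: GreenbergLNM1716, §1 pp. 60, 65] -/
theorem coinvariantsRank_eq_zpCorank_inf_invariantsUnder (hγ : κ.IsTopGenerator γ)
    (Hs : AddSubgroup (W.subgroupH1 p κ.kerSubgroup)) (hH : ∀ c ∈ Hs, W.conjH1 p κ.kerSubgroup γ c ∈ Hs)
    {Y : Type*} [AddCommGroup Y] [Module (IwasawaAlgebra p) Y] [Module.Finite (IwasawaAlgebra p) Y]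
    (dY : Y →+ (Hs →+ AddCircle (1 : ℚ))) (hbij : Function.Bijective dY)
    (hT : ∀ (y : Y) (c : Hs), dY ((PowerSeries.X : IwasawaAlgebra p) • y) c =
      dY y ⟨W.conjH1 p κ.kerSubgroup γ c, hH c c.2⟩ - dY y c)
    (hC : ∀ (a : ℤ_[p]) (y : Y) (c : Hs) (k : ℕ), (p ^ k) • c = 0 →
      dY (PowerSeries.C a • y) c = (PadicInt.toZModPow k a).val • dY y c)
    (hfin : Set.Finite {c : W.subgroupH1 p κ.kerSubgroup |
      c ∈ Hs ∧ p • c = 0 ∧ W.conjH1 p κ.kerSubgroup γ c = c}) :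
    coinvariantsRank p Y = zpCorank ↥(Hs ⊓ W.invariantsUnder κ γ) p := by
  -- the restricted conjugation `φ = conj_γ|_H`
  let φ : AddMonoid.End Hs :=
    AddMonoidHom.mk' (fun c ↦ ⟨W.conjH1 p κ.kerSubgroup γ c, hH c c.2⟩)
      (fun a b ↦ Subtype.ext (by
        change W.conjH1 p κ.kerSubgroup γ ((a : W.subgroupH1 p κ.kerSubgroup) + b) =
          W.conjH1 p κ.kerSubgroup γ a + W.conjH1 p κ.kerSubgroup γ b
        exact map_add _ _ _))
  have hφ : ∀ s : Hs, ((φ s : Hs) : W.subgroupH1 p κ.kerSubgroup) = W.conjH1 p κ.kerSubgroup γ s :=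
    fun _ ↦ rfl
  have hpair : IsDualPair p (φ - 1) dY :=
    { bijective := hbij
      T_smul := fun y c ↦ by rw [hT, End_sub_apply, AddMonoid.End.one_apply, map_sub]; rfl
      C_smul := fun a y c k hk ↦ hC a y c k hk
      locNil := W.isLocNil_sub_one_of_coe_eq_conjH1 κ hγ Hs φ hφ }
  -- `S^ψ = H^γ` as groups
  have hmem : ∀ s : Hs, s ∈ endInvariants (φ - 1) ↔
      (s : W.subgroupH1 p κ.kerSubgroup) ∈ Hs ⊓ W.invariantsUnder κ γ := fun s ↦ by
    rw [mem_endInvariants_iff, End_sub_apply, AddMonoid.End.one_apply, sub_eq_zero, AddSubgroup.mem_inf,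
      mem_invariantsUnder_iff, ← hφ]
    exact ⟨fun h ↦ ⟨s.2, congrArg Subtype.val h⟩, fun h ↦ Subtype.ext h.2⟩
  let e : ↥(endInvariants (φ - 1)) ≃+ ↥(Hs ⊓ W.invariantsUnder κ γ) :=
    { toFun := fun s ↦ ⟨(s : Hs), (hmem s).1 s.2⟩
      invFun := fun c ↦ ⟨⟨c, (AddSubgroup.mem_inf.1 c.2).1⟩, (hmem _).2 c.2⟩
      left_inv := fun s ↦ rfl
      right_inv := fun c ↦ rfl
      map_add' := fun a b ↦ rfl }
  -- `S^ψ[p]` is finite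
  haveI : Finite {c : W.subgroupH1 p κ.kerSubgroup |
      c ∈ Hs ∧ p • c = 0 ∧ W.conjH1 p κ.kerSubgroup γ c = c} := hfin.to_subtype
  haveI : Finite (↥(endInvariants (φ - 1)))[(p : ℤ)] := by
    refine Finite.of_injective (fun s : (↥(endInvariants (φ - 1)))[(p : ℤ)] ↦
      (⟨(((s : endInvariants (φ - 1)) : Hs) : W.subgroupH1 p κ.kerSubgroup), ?_⟩ :
        {c : W.subgroupH1 p κ.kerSubgroup |
          c ∈ Hs ∧ p • c = 0 ∧ W.conjH1 p κ.kerSubgroup γ c = c})) ?_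
    · have h1 := (hmem _).1 (s : endInvariants (φ - 1)).2
      rw [AddSubgroup.mem_inf, mem_invariantsUnder_iff] at h1
      have h2 : p • (s : endInvariants (φ - 1)) = 0 := AddSubgroup.torsionBy.nsmul_iff.mp s.2
      have h3 := congrArg (fun z : endInvariants (φ - 1) ↦ ((z : Hs) : W.subgroupH1 p κ.kerSubgroup)) h2
      simp only [AddSubgroupClass.coe_nsmul, ZeroMemClass.coe_zero] at h3
      exact ⟨h1.1, h3, h1.2⟩
    · intro a b hab
      exact Subtype.ext (Subtype.ext (Subtype.ext (by simpa using congrArg Subtype.val hab)))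
  rw [coinvariantsRank_eq_zpCorank_endInvariants p (φ - 1) dY hpair, zpCorank_congr e]

end Pontryagin

section Control

variable {K : Type u} [Field K] [NumberField K] (W : WeierstrassCurve K) {p : ℕ} [Fact p.Prime]
  (κ : ZpExtension K p) {γ : Field.absoluteGaloisGroup K}

/-- **A class of `H¹(Γ_K, E[p^∞])` whose restriction to `K_∞` is unramified outside `Σ₀ ∪ {v ∣ p}` is itself
unramified there**: for `v ∤ p` the inertia group `I_v` of the chosen place lies in `Gal(K̄/K_∞)`
(`ℤ_p`-extensions are unramified outside `p`, `ZpExtension.inertia_le_kerSubgroup_holds`, Washington 13.2),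
so `⊤ ⊓ I_v` and `ker κ ⊓ I_v` are the same group and the two restrictions to it are the same cocycles
(cocycle criterion `CocycleCriteria.resH1Hom_oneCocycleClass_eq_zero_iff`). [cite: Washington1997, Prop. 13.2]
[cite: GreenbergVatsal2000, §2 p. 16] -/
theorem mem_unramifiedOutside_top_of_resOfLe_mem (S₀ : Set (HeightOneSpectrum (𝓞 K)))
    (y : W.subgroupH1 p (⊤ : Subgroup (Field.absoluteGaloisGroup K)))
    (hy : W.resOfLe p (le_top : κ.kerSubgroup ≤ ⊤) y ∈
      unramifiedOutside κ.kerSubgroup (W.geomPrimaryTorsion p) p S₀) :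
    y ∈ unramifiedOutside (⊤ : Subgroup (Field.absoluteGaloisGroup K)) (W.geomPrimaryTorsion p) p S₀ := by
  rw [mem_unramifiedOutside_iff] at hy ⊢
  intro v hv hpv σ
  -- `I_v ≤ ker κ` for `v ∤ p`
  have hI : inertia v ≤ κ.kerSubgroup := by
    intro x hx
    obtain ⟨τ, hτ, rfl⟩ := hx
    have hτ' : absGaloisRestrict K (v.adicCompletion K) τ ∈
        (adicCompletionPrime K v).inertia (Field.absoluteGaloisGroup K) := by
      rw [inertia_adicCompletionPrime_eq_map_absInertia]
      exact Subgroup.mem_map_of_mem _ hτ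
    have hpv' : (p : 𝓞 K) ∉ v.asIdeal := by exact_mod_cast hpv
    exact ZpExtension.inertia_le_kerSubgroup_holds K p κ hpv' (adicCompletionPrime_mem_primesAbove K v) hτ'
  -- `conj_σ = id` at level `Γ_K`, `conj_1 = id` at level `ker κ`
  have h1 : Literature.NumberTheory.EllipticCurves.conjH1 ⊤ (W.geomPrimaryTorsion p) σ = AddMonoidHom.id _ :=
    conjH1_of_mem_holds ⊤ _ (Subgroup.mem_top σ)
  rw [h1, AddMonoidHom.id_apply]
  have hx := hy v hv hpv 1
  have h2 : Literature.NumberTheory.EllipticCurves.conjH1 κ.kerSubgroup (W.geomPrimaryTorsion p) 1 =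
      AddMonoidHom.id _ :=
    conjH1_of_mem_holds κ.kerSubgroup _ (one_mem _)
  rw [h2, AddMonoidHom.id_apply] at hx
  -- cocycle level
  obtain ⟨f, rfl⟩ := oneCocycleClass_surjective _ y
  have hmap : W.resOfLe p (le_top : κ.kerSubgroup ≤ ⊤) (oneCocycleClass _ f) = oneCocycleClass _
      (contOneCocycles.pullback (subgroupInclusion (le_top : κ.kerSubgroup ≤ ⊤))
        (resHomOfEquivariant (subgroupInclusion (le_top : κ.kerSubgroup ≤ ⊤))
          (AddMonoidHom.id (W.geomPrimaryTorsion p)) (fun _ _ ↦ rfl)) f) :=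
    map_oneCocycleClass _ _ _ f
  rw [hmap, GreenbergVatsal2000.unramifiedKer, AddMonoidHom.mem_ker,
    CocycleCriteria.resH1Hom_oneCocycleClass_eq_zero_iff] at hx
  obtain ⟨m, hm⟩ := hx
  rw [GreenbergVatsal2000.unramifiedKer, AddMonoidHom.mem_ker,
    CocycleCriteria.resH1Hom_oneCocycleClass_eq_zero_iff]
  refine ⟨m, fun x ↦ ?_⟩
  have hxI : ((x : decomp v) : Field.absoluteGaloisGroup K) ∈ inertia v :=
    ((mem_inertiaIn_iff ⊤ v _).1 x.2).2
  exact hm ⟨(x : decomp v), (mem_inertiaIn_iff κ.kerSubgroup v _).2 ⟨hI hxI, hxI⟩⟩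

/-- **The control map is onto `H¹(K_∞, E[p^∞])^γ`**: a class fixed by `conj_γ` (`γ` a topological generator
of `κ`) is the restriction of a class of `H¹(Γ_K, E[p^∞])` — Greenberg's Lemma 3.2 at `n = 0` (tree
`ZpExtension.mem_range_resOfLe_of_conjH1_eq`, inflation–restriction with `H²(Γ, ·) = 0`), moved from the
layer group `κ⁻¹(p⁰ℤ_p)` to `⊤` along `resOfLe_comp`. [cite: GreenbergLNM1716, §3 Lemma 3.2; §4 p. 119
(«is surjective and has finite kernel»)] -/
theorem exists_resOfLe_top_eq_of_conjH1_eq (hγ : κ.IsTopGenerator γ) (x : W.subgroupH1 p κ.kerSubgroup)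
    (hx : W.conjH1 p κ.kerSubgroup γ x = x) :
    ∃ y : W.subgroupH1 p (⊤ : Subgroup (Field.absoluteGaloisGroup K)),
      W.resOfLe p (le_top : κ.kerSubgroup ≤ ⊤) y = x := by
  have hprim : ∀ m : W.geomPrimaryTorsion p, ∃ k : ℕ, p ^ k • m = 0 := fun m ↦ by
    obtain ⟨k, hk⟩ := m.2
    exact ⟨k, Subtype.ext (by rw [AddSubgroupClass.coe_nsmul, hk, ZeroMemClass.coe_zero])⟩
  have hx' : W.conjH1 p κ.kerSubgroup (γ ^ p ^ 0) x = x := by rwa [pow_zero, pow_one]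
  obtain ⟨z, hz⟩ := ZpExtension.mem_range_resOfLe_of_conjH1_eq κ hγ 0
    (W.continuous_smul_geomPrimaryTorsion p) hprim x hx'
  have htop : (⊤ : Subgroup (Field.absoluteGaloisGroup K)) ≤ κ.layerSubgroup 0 :=
    fun g _ ↦ by rw [ZpExtension.layerSubgroup_zero]; trivial
  refine ⟨W.resOfLe p htop z, ?_⟩
  have hcomp := congrArg (fun f ↦ f z) (W.resOfLe_comp_holds p (le_top : κ.kerSubgroup ≤ ⊤) htop)
  simp only [AddMonoidHom.coe_comp, Function.comp_apply] at hcomp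
  rw [hcomp]
  exact hz

/-- **The control map has finite kernel** (Greenberg's Lemma 3.1 at `n = 0`, tree `finite_ker_layerToInfty`):
`ker(H¹(Γ_K, ·) → H¹(K_∞, ·))` embeds in `ker(H¹(κ⁻¹(p⁰ℤ_p), ·) → H¹(K_∞, ·))` by restriction along
`κ⁻¹(p⁰ℤ_p) ≤ ⊤` (a bijection, `resOfLe_comp`, `resOfLe_refl`). [cite: GreenbergLNM1716, §3 Lemma 3.1] -/
theorem finite_ker_resOfLe_top [W.IsElliptic] (hγ : κ.IsTopGenerator γ) :
    Finite (W.resOfLe p (le_top : κ.kerSubgroup ≤ ⊤)).ker := by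
  haveI := W.finite_ker_layerToInfty (κ := κ) hγ 0
  have htop : (⊤ : Subgroup (Field.absoluteGaloisGroup K)) ≤ κ.layerSubgroup 0 :=
    fun g _ ↦ by rw [ZpExtension.layerSubgroup_zero]; trivial
  have hid : ∀ y : W.subgroupH1 p (⊤ : Subgroup (Field.absoluteGaloisGroup K)),
      W.resOfLe p htop (W.resOfLe p (le_top : κ.layerSubgroup 0 ≤ ⊤) y) = y := fun y ↦ by
    have hcomp := congrArg (fun f ↦ f y) (W.resOfLe_comp_holds p htop (le_top : κ.layerSubgroup 0 ≤ ⊤))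
    simp only [AddMonoidHom.coe_comp, Function.comp_apply] at hcomp
    rw [hcomp]
    exact congrArg (fun f ↦ f y)
      (Literature.NumberTheory.EllipticCurves.resOfLe_refl_holds (M := W.geomPrimaryTorsion p) ⊤)
  refine Finite.of_injective (fun y : (W.resOfLe p (le_top : κ.kerSubgroup ≤ ⊤)).ker ↦
    (⟨W.resOfLe p (le_top : κ.layerSubgroup 0 ≤ ⊤) (y : W.subgroupH1 p ⊤), ?_⟩ :
      (W.layerToInfty κ 0).ker)) ?_
  · have hy : W.resOfLe p (le_top : κ.kerSubgroup ≤ ⊤) (y : W.subgroupH1 p ⊤) = 0 := y.2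
    rw [AddMonoidHom.mem_ker]
    have hcomp := congrArg (fun f ↦ f (y : W.subgroupH1 p ⊤))
      (W.resOfLe_comp_holds p (κ.kerSubgroup_le_layerSubgroup 0) (le_top : κ.layerSubgroup 0 ≤ ⊤))
    simp only [AddMonoidHom.coe_comp, Function.comp_apply] at hcomp
    change W.resOfLe p (κ.kerSubgroup_le_layerSubgroup 0)
      (W.resOfLe p (le_top : κ.layerSubgroup 0 ≤ ⊤) (y : W.subgroupH1 p ⊤)) = 0
    rw [hcomp]
    exact hy
  · intro a b hab
    have h := congrArg (fun z : (W.layerToInfty κ 0).ker ↦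
      W.resOfLe p htop (z : W.subgroupH1 p (κ.layerSubgroup 0))) hab
    simp only [hid] at h
    exact Subtype.ext h

omit [Fact p.Prime] in
/-- Every class of `H¹(Γ_K, E[p^∞])` is killed by a power of `p` (`Γ_K` compact, `E[p^∞]` discrete and
`p`-primary: a continuous cocycle takes finitely many values). Greenberg (1999), §1 p. 60. [folklore] -/
theorem exists_pow_smul_subgroupH1_top_eq_zero
    (c : W.subgroupH1 p (⊤ : Subgroup (Field.absoluteGaloisGroup K))) : ∃ k : ℕ, p ^ k • c = 0 := by
  haveI := compactSpace_absoluteGaloisGroup K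
  haveI : CompactSpace (⊤ : Subgroup (Field.absoluteGaloisGroup K)) :=
    isCompact_iff_compactSpace.mp (by rw [Subgroup.coe_top]; exact isCompact_univ)
  obtain ⟨φ, rfl⟩ := oneCocycleClass_surjective _ c
  exact IwasawaDual.exists_pow_smul_oneCocycleClass_eq_zero φ fun σ ↦ by
    obtain ⟨k, hk⟩ := (φ.1 σ).2
    exact ⟨k, Subtype.ext (by rw [AddSubgroupClass.coe_nsmul]; exact hk)⟩

/-- **`corank_{ℤ_p} H¹(K_Σ/K_∞, E[p^∞])^Γ = corank_{ℤ_p} H¹(K_Σ/K, E[p^∞])`**: the control map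
`res : unramifiedOutside ⊤ E[p^∞] p Σ₀ → unramifiedOutside (ker κ) E[p^∞] p Σ₀ ⊓ H¹(K_∞, E[p^∞])^γ` is well defined
(part 7 `resOfLe_mem_unramifiedOutside`, `conjH1_resOfLe_top`), onto (`exists_resOfLe_top_eq_of_conjH1_eq` +
`mem_unramifiedOutside_top_of_resOfLe_mem`) with finite kernel (`finite_ker_resOfLe_top`); both groups are
`p`-primary with finite `p`-torsion (`finite_setOf_unramifiedOutside_pTorsion_conjH1_eq` for the target, the
source's `p`-torsion then being an extension of a subgroup of it by a finite group), so
`zpCorank_eq_of_finite_ker_of_finite_coker` applies. Greenberg (1999), §4 p. 119: «Since the map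
`H¹(F_Σ/F, E[p^∞]) → H¹(F_Σ/F_∞, E[p^∞])^Γ` is surjective and has finite kernel». [cite: GreenbergLNM1716, §4 p. 119] -/
theorem zpCorank_unramifiedOutside_inf_invariantsUnder_eq_top [W.IsElliptic] (hγ : κ.IsTopGenerator γ)
    {S₀ : Set (HeightOneSpectrum (𝓞 K))} (hS₀ : S₀.Finite) :
    zpCorank ↥(unramifiedOutside κ.kerSubgroup (W.geomPrimaryTorsion p) p S₀ ⊓ W.invariantsUnder κ γ) p =
      zpCorank ↥(unramifiedOutside (⊤ : Subgroup (Field.absoluteGaloisGroup K))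
        (W.geomPrimaryTorsion p) p S₀) p := by
  set Hγ : AddSubgroup (W.subgroupH1 p κ.kerSubgroup) :=
    unramifiedOutside κ.kerSubgroup (W.geomPrimaryTorsion p) p S₀ ⊓ W.invariantsUnder κ γ
  set G : AddSubgroup (W.subgroupH1 p (⊤ : Subgroup (Field.absoluteGaloisGroup K))) :=
    unramifiedOutside (⊤ : Subgroup (Field.absoluteGaloisGroup K)) (W.geomPrimaryTorsion p) p S₀
  -- the control map
  have hfmem : ∀ y : G, W.resOfLe p (le_top : κ.kerSubgroup ≤ ⊤) (y : W.subgroupH1 p ⊤) ∈ Hγ := fun y ↦ by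
    refine AddSubgroup.mem_inf.2 ⟨?_, ?_⟩
    · exact resOfLe_mem_unramifiedOutside (W.geomPrimaryTorsion p) (le_top : κ.kerSubgroup ≤ ⊤) p S₀ y.2
    · rw [mem_invariantsUnder_iff]
      exact conjH1_resOfLe_top W κ γ (y : W.subgroupH1 p ⊤)
  let f : G →+ Hγ :=
    AddMonoidHom.mk' (fun y ↦ ⟨W.resOfLe p (le_top : κ.kerSubgroup ≤ ⊤) (y : W.subgroupH1 p ⊤), hfmem y⟩)
      (fun a b ↦ Subtype.ext (by
        change W.resOfLe p (le_top : κ.kerSubgroup ≤ ⊤) ((a : W.subgroupH1 p ⊤) + b) = _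
        rw [map_add]; rfl))
  have hf : ∀ y : G, ((f y : Hγ) : W.subgroupH1 p κ.kerSubgroup) =
      W.resOfLe p (le_top : κ.kerSubgroup ≤ ⊤) (y : W.subgroupH1 p ⊤) := fun _ ↦ rfl
  -- onto
  have hsurj : Function.Surjective f := by
    intro x
    have hx := (AddSubgroup.mem_inf.1 x.2)
    obtain ⟨y, hy⟩ := exists_resOfLe_top_eq_of_conjH1_eq W κ hγ (x : W.subgroupH1 p κ.kerSubgroup)
      ((W.mem_invariantsUnder_iff κ γ _).1 hx.2)
    have hyG : y ∈ G := mem_unramifiedOutside_top_of_resOfLe_mem W κ S₀ y (by rw [hy]; exact hx.1)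
    exact ⟨⟨y, hyG⟩, Subtype.ext (by rw [hf]; exact hy)⟩
  -- finite kernel
  haveI : Finite f.ker := by
    haveI := finite_ker_resOfLe_top W κ hγ (p := p)
    refine Finite.of_injective (fun y : f.ker ↦
      (⟨((y : G) : W.subgroupH1 p ⊤), ?_⟩ : (W.resOfLe p (le_top : κ.kerSubgroup ≤ ⊤)).ker)) ?_
    · have hy : f (y : G) = 0 := y.2
      rw [AddMonoidHom.mem_ker, ← hf, hy]
      rfl
    · intro a b hab
      exact Subtype.ext (Subtype.ext (by simpa using congrArg Subtype.val hab))
  -- finite cokernel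
  haveI : Finite (Hγ ⧸ f.range) := by
    rw [AddMonoidHom.range_eq_top.2 hsurj]
    infer_instance
  -- `p`-primary
  have hB : ∀ b : Hγ, ∃ n : ℕ, p ^ n • b = 0 := fun b ↦ by
    obtain ⟨k, hk⟩ := W.exists_pow_smul_subgroupH1_ker_eq_zero κ (b : W.subgroupH1 p κ.kerSubgroup)
    exact ⟨k, Subtype.ext (by rw [AddSubgroupClass.coe_nsmul, hk]; rfl)⟩
  have hA : ∀ a : G, ∃ n : ℕ, p ^ n • a = 0 := fun a ↦ by
    obtain ⟨k, hk⟩ := exists_pow_smul_subgroupH1_top_eq_zero W (p := p) (a : W.subgroupH1 p ⊤)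
    exact ⟨k, Subtype.ext (by rw [AddSubgroupClass.coe_nsmul, hk]; rfl)⟩
  -- finite `p`-torsion of the target
  haveI hfinT : Finite {c : W.subgroupH1 p κ.kerSubgroup |
      c ∈ unramifiedOutside κ.kerSubgroup (W.geomPrimaryTorsion p) p S₀ ∧ p • c = 0 ∧
        W.conjH1 p κ.kerSubgroup γ c = c} :=
    (W.finite_setOf_unramifiedOutside_pTorsion_conjH1_eq κ hγ hS₀).to_subtype
  haveI : Finite (↥Hγ)[(p : ℤ)] := by
    refine Finite.of_injective (fun c : (↥Hγ)[(p : ℤ)] ↦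
      (⟨((c : Hγ) : W.subgroupH1 p κ.kerSubgroup), ?_⟩ :
        {c : W.subgroupH1 p κ.kerSubgroup |
          c ∈ unramifiedOutside κ.kerSubgroup (W.geomPrimaryTorsion p) p S₀ ∧ p • c = 0 ∧
            W.conjH1 p κ.kerSubgroup γ c = c})) ?_
    · have h1 := AddSubgroup.mem_inf.1 (c : Hγ).2
      rw [mem_invariantsUnder_iff] at h1
      have h2 : p • (c : Hγ) = 0 := AddSubgroup.torsionBy.nsmul_iff.mp c.2
      have h3 := congrArg (fun z : Hγ ↦ (z : W.subgroupH1 p κ.kerSubgroup)) h2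
      simp only [AddSubgroupClass.coe_nsmul, ZeroMemClass.coe_zero] at h3
      exact ⟨h1.1, h3, h1.2⟩
    · intro a b hab
      exact Subtype.ext (Subtype.ext (by simpa using congrArg Subtype.val hab))
  -- finite `p`-torsion of the source: `G[p] → Hγ[p]` has kernel inside `ker f`
  haveI : Finite (↥G)[(p : ℤ)] := by
    let φ : (↥G)[(p : ℤ)] →+ (↥Hγ)[(p : ℤ)] :=
      (f.comp ((↥G)[(p : ℤ)]).subtype).codRestrict _ (fun c ↦ by
        rw [AddSubgroup.torsionBy.nsmul_iff, AddMonoidHom.coe_comp, Function.comp_apply, ← map_nsmul,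
          AddSubgroup.coe_subtype, ← AddSubgroupClass.coe_nsmul, AddSubgroup.torsionBy.nsmul c, ZeroMemClass.coe_zero,
          map_zero])
    haveI : Finite φ.ker := by
      refine Finite.of_injective (fun c : φ.ker ↦ (⟨((c : (↥G)[(p : ℤ)]) : G), ?_⟩ : f.ker)) ?_
      · have hc : φ (c : (↥G)[(p : ℤ)]) = 0 := c.2
        rw [AddMonoidHom.mem_ker]
        simpa [φ] using congrArg Subtype.val hc
      · intro a b hab
        exact Subtype.ext (Subtype.ext (by simpa using congrArg Subtype.val hab))
    haveI : Finite φ.range := inferInstance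
    haveI : Finite ((↥G)[(p : ℤ)] ⧸ φ.ker) :=
      Finite.of_equiv _ (QuotientAddGroup.quotientKerEquivRange φ).symm.toEquiv
    exact Finite.of_addSubgroup_quotient φ.ker
  exact (zpCorank_eq_of_finite_ker_of_finite_coker f hA hB).symm

end Control

section Composite

variable {K : Type u} [Field K] [NumberField K] (W : WeierstrassCurve K) {p : ℕ} [Fact p.Prime]
  (κ : ZpExtension K p) {γ : Field.absoluteGaloisGroup K}

/-- **`rank_{ℤ_p} Y/TY = corank_{ℤ_p} H¹(K_Σ/K, E[p^∞])`** for every finitely generated Pontryagin-dual datum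
`Y` of `H¹(K_Σ/K_∞, E[p^∞]) = unramifiedOutside (ker κ) E[p^∞] p Σ₀` (`κ` any `ℤ_p`-extension with topological
generator `γ`, `Σ₀` finite): §1 (`Y/TY ≅ Hom(H^Γ, ℚ/ℤ)`) and §2 (control, onto with finite kernel).
Greenberg (1999), §4 p. 119. [cite: GreenbergLNM1716, §4 p. 119; §1 p. 65] -/
theorem coinvariantsRank_eq_zpCorank_unramifiedOutside_top [W.IsElliptic] (hγ : κ.IsTopGenerator γ)
    {S₀ : Set (HeightOneSpectrum (𝓞 K))} (hS₀ : S₀.Finite)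
    {Y : Type*} [AddCommGroup Y] [Module (IwasawaAlgebra p) Y] [Module.Finite (IwasawaAlgebra p) Y]
    (dY : Y →+ (unramifiedOutside κ.kerSubgroup (W.geomPrimaryTorsion p) p S₀ →+ AddCircle (1 : ℚ)))
    (hbij : Function.Bijective dY)
    (hT : ∀ (y : Y) (x : unramifiedOutside κ.kerSubgroup (W.geomPrimaryTorsion p) p S₀),
      dY ((PowerSeries.X : IwasawaAlgebra p) • y) x =
        dY y ⟨W.conjH1 p κ.kerSubgroup γ x,
          conjH1_mem_unramifiedOutside κ.kerSubgroup (W.geomPrimaryTorsion p) p _ γ x.2⟩ - dY y x)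
    (hC : ∀ (a : ℤ_[p]) (y : Y) (x : unramifiedOutside κ.kerSubgroup (W.geomPrimaryTorsion p) p S₀) (k : ℕ),
      (p ^ k) • x = 0 → dY (PowerSeries.C a • y) x = (PadicInt.toZModPow k a).val • dY y x) :
    coinvariantsRank p Y =
      zpCorank ↥(unramifiedOutside (⊤ : Subgroup (Field.absoluteGaloisGroup K))
        (W.geomPrimaryTorsion p) p S₀) p := by
  rw [coinvariantsRank_eq_zpCorank_inf_invariantsUnder W κ hγ
    (unramifiedOutside κ.kerSubgroup (W.geomPrimaryTorsion p) p S₀)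
    (fun c hc ↦ conjH1_mem_unramifiedOutside κ.kerSubgroup (W.geomPrimaryTorsion p) p _ γ hc) dY hbij hT hC
    (W.finite_setOf_unramifiedOutside_pTorsion_conjH1_eq κ hγ hS₀)]
  exact zpCorank_unramifiedOutside_inf_invariantsUnder_eq_top W κ hγ hS₀

end Composite

end Summit.BirchSwinnertonDyer.BirchSwinnertonDyer.Theorems.SSFlatEC

end
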